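import Summits.BirchSwinnertonDyer.BirchSwinnertonDyer.Theorems.ResidualThetaTransportAtTwoThetaLayerLambdaCongruenceAtTwoCosocleKanPlus
import HarnessLib

/-!
# Crux Kan⁺ `ThetaLayerLambdaCongruenceAtTwo` (stmt-BirchSwinnertonDyer-20688), line `birth`: THE TWO FLOORS MEET AT THE CURVE-LEVEL COSOCLE STATEMENT —
# `hcosW` ⟸ PUB² {SD, Bz} (this file) and `hcosW` ⟸ {Bz on the Picard carrier} (`…CosocleKanPlus`); Kan⁺ / K1 see print ONLY through `hcosW`
# (width seat bsd-wall-rtt-p3-w3 g10; `--supports stmt-BirchSwinnertonDyer-20688`; THEOREMS ONLY — no `def`, no `sorry`; BSD is not proved)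

`hcosW` := «for `W/ℚ` globally minimal with `GoodSS W 2`, every odd level `L` with all `p ∤ 2L` good, and every maximal `𝔪 ∋ 2` of
`𝕋 = HeckeRing0 L 2` with `|𝕋/𝔪| = 2` and `T_q − a_q(W) ∈ 𝔪` (`q ∤ L`): `dim_{𝕋/𝔪} Λ/𝔪Λ = 2`, `Λ = periodHomologyHecke L = H₁(X₀(L); ℤ)`»
— Galois-free and pairing-free. Landed: `thetaLayerLambdaCongruenceAtTwo_of_cosocleW : hcosW → Kan⁺` (p649433) and the K1 twins
(`…MazurTateCongruenceAtTwoTopOfCosocle`). THIS FILE proves `hcosW` from the CURRENT floor PUB² {`heckeSelfDual_torsionBy_J0`,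
`buzzard2000_multiplicityOne_gamma0`}:
* §1 `natCard_torsion_le_natCard_quotient_of_pairing` — `|M[I]| ≤ |M/IM|` from the RIGHT kernel of a balanced `ℤ/2`-pairing (companion of the
  left-kernel inequality `natCard_quotient_smul_top_le_of_pairing` of `…StarFourCosets`);
* §2 `finrank_periodHomology_quotient_eq_two_of_selfDual_sub` — `dim Λ/𝔪Λ = 2` from `dim J₀(L)[𝔪] = 2`, `|𝕋/𝔪| = 2` and a two-sided
  self-duality pairing on `J₀(L)[2]` (steps (1)–(5) of `exists_fourCosets_periodHomology_of_multiplicityOne` + ontoness + §1);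
* §3 **`cosocleW_of_sdBz : SD → Bz → hcosW`**, `cosocleW_of_aliasInputs` (items 27800, 27798 BY NAME), `cosocleW_of_pub` (item 27435).
USE (planner-facing): a skeleton for 20688 with the SINGLE stub `stub_cosocleMultOne : hcosW` and
`ThetaLayerLambdaCongruenceAtTwo_of := thetaLayerLambdaCongruenceAtTwo_of_cosocleW stub_cosocleMultOne` is DECISION-AGNOSTIC: the stub is
`cosocleW_of_aliasInputs h27800 h27798` under the current typing of Buzzard's Prop. 2.4 (Albanese coordinate) and `cosocleAtEigenIdeal_of_cosocleFact h`
under the Picard typing (then item 27800 is idle). Nothing here asserts either fact; BSD is not proved by any of this.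

References: Darmon–Diamond–Taylor (1995) §1.6 Lemma 1.38, §4.5 Thm. 4.26, pp. 133–134 [DarmonDiamondTaylor1995]; Buzzard, MRL 7 (2000) Prop. 2.4
[Buzzard2000LevelLoweringModTwo]; Tilouine (1997) Thm. 3.4 [Tilouine1997Gorenstein].
-/

-- justification: the `Summit.BirchSwinnertonDyer.BirchSwinnertonDyer.…` path repeats a component (route-file convention)
set_option linter.dupNamespace false
set_option autoImplicit false

noncomputable section

open scoped MatrixGroups ComplexConjugate ModularForm NumberField Pointwise Classical
open CongruenceSubgroup Complex WeierstrassCurve IsDedekindDomain Polynomial Field Matrix Literature.NumberTheory.GaloisRepresentations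
open Literature.NumberTheory.EllipticCurves Literature.NumberTheory.EllipticCurves.ModularForms
open Literature.NumberTheory.EllipticCurves.Rank1Residual Rat.HeightOneSpectrum
open Summit.BirchSwinnertonDyer.BirchSwinnertonDyer.Theses.ResidualThetaTransportAtTwo

namespace Summit.BirchSwinnertonDyer.BirchSwinnertonDyer.Theorems.ThetaLayerLambdaCongruenceAtTwo

/-! ## §1 `|M[I]| ≤ |M/IM|` from the RIGHT kernel of a balanced pairing -/

section Pairing

variable {R M : Type*} [CommRing R] [AddCommGroup M] [Module R M]

/-- **`|M[I]| ≤ |M/IM|` from a balanced pairing with trivial RIGHT kernel** (companion of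
`natCard_quotient_smul_top_le_of_pairing`, which gives `|M/IM| ≤ |M[I]|` from the LEFT kernel). `M` a finite `R`-module killed by `2`,
`B : M × M → ℤ/2` biadditive with `B(t x, y) = B(x, t y)`; for `y ∈ M[I]` the character `B(·, y)` kills `IM`
(`B(t x, y) = B(x, t y) = 0`), and `y ↦ B(·, y)` is injective `M[I] → Hom(M/IM, ℤ/2)`, a group of order `|M/IM|`.
[cite: DarmonDiamondTaylor1995, §4.5 (p. 134)] -/
theorem natCard_torsion_le_natCard_quotient_of_pairing [Finite M] (h2 : ∀ x : M, (2 : ℕ) • x = 0)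
    (B : M →+ (M →+ ZMod 2)) (hbal : ∀ (t : R) (x y : M), B (t • x) y = B x (t • y))
    (hright : ∀ y : M, (∀ x, B x y = 0) → y = 0) (I : Ideal R) :
    Nat.card {x : M // ∀ t ∈ I, t • x = 0} ≤ Nat.card (M ⧸ (I • ⊤ : Submodule R M)) := by
  classical
  set N : Submodule R M := I • ⊤ with hN
  haveI : Finite (M ⧸ N) := Finite.of_surjective _ (Submodule.Quotient.mk_surjective N)
  have h2Q : ∀ q : M ⧸ N, (2 : ℕ) • q = 0 := fun q ↦ by
    obtain ⟨x, rfl⟩ := Submodule.Quotient.mk_surjective N q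
    rw [← Submodule.mkQ_apply, ← map_nsmul, h2 x, map_zero]
  rw [← natCard_addMonoidHom_zmod_two h2Q]
  -- for `y ∈ M[I]`, `B(·, y)` kills `N = IM`
  have hkill : ∀ y : {x : M // ∀ t ∈ I, t • x = 0}, ∀ n ∈ N, B n (y : M) = 0 := by
    intro y n hn
    refine Submodule.smul_induction_on hn (fun t ht m _ ↦ ?_) (fun a b ha hb ↦ ?_)
    · rw [hbal, y.2 t ht, map_zero]
    · rw [map_add, AddMonoidHom.add_apply, ha, hb, add_zero]
  haveI : Finite (M ⧸ N →+ ZMod 2) :=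
    Finite.of_injective (fun f : M ⧸ N →+ ZMod 2 ↦ (⇑f : M ⧸ N → ZMod 2)) DFunLike.coe_injective
  let G : {x : M // ∀ t ∈ I, t • x = 0} → (M ⧸ N →+ ZMod 2) := fun y ↦
    QuotientAddGroup.lift N.toAddSubgroup (B.flip (y : M)) fun n hn ↦ (AddMonoidHom.mem_ker).mpr (hkill y n hn)
  have hG : ∀ (y : {x : M // ∀ t ∈ I, t • x = 0}) (x : M), G y (N.mkQ x) = B x (y : M) := fun y x ↦ rfl
  have hGinj : Function.Injective G := by
    intro y₁ y₂ h
    apply Subtype.ext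
    rw [← sub_eq_zero]
    apply hright
    intro x
    have hx : G y₁ (N.mkQ x) = G y₂ (N.mkQ x) := by rw [h]
    rw [hG, hG] at hx
    rw [map_sub, hx, sub_self]
  exact Nat.card_le_card_of_injective G hGinj

end Pairing

/-! ## §2 Cosocle multiplicity one from the SUB form and a two-sided self-duality pairing on `J₀(L)[2]` -/

section PeriodHomology

/-- **`dim_{𝕋/𝔪} Λ/𝔪Λ = 2` from `dim_{𝕋/𝔪} J₀(L)[𝔪] = 2` and a `𝕋`-balanced pairing on `J₀(L)[2]` with trivial left AND right kernels**
(the content of `heckeSelfDual_torsionBy_J0` at `ℓ = 2`), for a maximal `𝔪 ∋ 2` with `|𝕋/𝔪| = 2`. Chain: `Λ/𝔪Λ ≅ M/𝔪M` (`M = J₀(L)[2]`,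
`x ↦ [x/2]` is onto with kernel `2Λ ⊆ 𝔪Λ`), `|M/𝔪M| ≤ |M[𝔪]|` (left kernel, `natCard_quotient_smul_top_le_of_pairing`) and
`|M[𝔪]| ≤ |M/𝔪M|` (right kernel, §1); so `|Λ/𝔪Λ| = |M[𝔪]| = |𝕋/𝔪|² = 4 = 2^{dim}`. (Steps (1)–(5) copied from
`exists_fourCosets_periodHomology_of_multiplicityOne`.) [cite: DarmonDiamondTaylor1995, §1.6 Lemma 1.38 and §4.5 Thm. 4.26 (pp. 133–134)] -/
theorem finrank_periodHomology_quotient_eq_two_of_selfDual_sub {L : ℕ} [NeZero L] (𝔪 : Ideal (HeckeRing0 L 2))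
    [h𝔪 : 𝔪.IsMaximal] (h2 : (2 : HeckeRing0 L 2) ∈ 𝔪) (hq : Nat.card (HeckeRing0 L 2 ⧸ 𝔪) = 2)
    (hsub : Module.finrank (HeckeRing0 L 2 ⧸ 𝔪) (Submodule.torsionBySet (HeckeRing0 L 2) (J0 L) 𝔪) = 2)
    (B : Submodule.torsionBy (HeckeRing0 L 2) (J0 L) ((2 : ℕ) : HeckeRing0 L 2) →+
      (Submodule.torsionBy (HeckeRing0 L 2) (J0 L) ((2 : ℕ) : HeckeRing0 L 2) →+ ZMod 2))
    (hbal : ∀ (t : HeckeRing0 L 2) x y, B (t • x) y = B x (t • y)) (hleft : ∀ x, (∀ y, B x y = 0) → x = 0)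
    (hright : ∀ y, (∀ x, B x y = 0) → y = 0) :
    Module.finrank (HeckeRing0 L 2 ⧸ 𝔪)
      (periodHomologyHecke L ⧸ (𝔪 • ⊤ : Submodule (HeckeRing0 L 2) (periodHomologyHecke L))) = 2 := by
  classical
  haveI hMfin : Finite (Submodule.torsionBy (HeckeRing0 L 2) (J0 L) ((2 : ℕ) : HeckeRing0 L 2)) := J0.finite_torsionBy L (ℓ := 2) two_ne_zero
  have h22 : ((2 : ℕ) : HeckeRing0 L 2) = 2 := Nat.cast_ofNat
  -- (1) `(Submodule.torsionBy (HeckeRing0 L 2) (J0 L) ((2 : ℕ) : HeckeRing0 L 2))` is killed by `2`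
  have h2M : ∀ x : (Submodule.torsionBy (HeckeRing0 L 2) (J0 L) ((2 : ℕ) : HeckeRing0 L 2)), (2 : ℕ) • x = 0 := fun x ↦ by
    have hx := x.2
    rw [Submodule.mem_torsionBy_iff] at hx
    apply Subtype.ext
    rw [AddSubgroupClass.coe_nsmul, ZeroMemClass.coe_zero, ← Nat.cast_smul_eq_nsmul (HeckeRing0 L 2)]
    exact hx
  -- (2) `|(Submodule.torsionBy (HeckeRing0 L 2) (J0 L) ((2 : ℕ) : HeckeRing0 L 2))/𝔪(Submodule.torsionBy (HeckeRing0 L 2) (J0 L) ((2 : ℕ) : HeckeRing0 L 2))| ≤ |(Submodule.torsionBy (HeckeRing0 L 2) (J0 L) ((2 : ℕ) : HeckeRing0 L 2))[𝔪]|`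
  have hleft' : ∀ x : (Submodule.torsionBy (HeckeRing0 L 2) (J0 L) ((2 : ℕ) : HeckeRing0 L 2)), B x = 0 → x = 0 := fun x hx ↦ hleft x fun y ↦ by rw [hx, AddMonoidHom.zero_apply]
  have hle := natCard_quotient_smul_top_le_of_pairing h2M B hbal hleft' 𝔪
  -- (3) `|(Submodule.torsionBy (HeckeRing0 L 2) (J0 L) ((2 : ℕ) : HeckeRing0 L 2))[𝔪]| = |J₀(L)[𝔪]| = |𝕋/𝔪|² = 4`
  have htors_le : Submodule.torsionBySet (HeckeRing0 L 2) (J0 L) 𝔪 ≤ (Submodule.torsionBy (HeckeRing0 L 2) (J0 L) ((2 : ℕ) : HeckeRing0 L 2)) := by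
    rw [h22]
    exact J0.torsionBySet_le_torsionBy L h2
  let e : {x : (Submodule.torsionBy (HeckeRing0 L 2) (J0 L) ((2 : ℕ) : HeckeRing0 L 2)) // ∀ t ∈ 𝔪, t • x = 0} ≃ Submodule.torsionBySet (HeckeRing0 L 2) (J0 L) 𝔪 :=
    { toFun := fun x ↦ ⟨(x.1 : J0 L), (Submodule.mem_torsionBySet_iff _ _).mpr fun t ↦ by
        have h := congrArg Subtype.val (x.2 t t.2)
        exact h⟩
      invFun := fun j ↦ ⟨⟨(j : J0 L), htors_le j.2⟩, fun t ht ↦ Subtype.ext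
        ((Submodule.mem_torsionBySet_iff _ _).mp j.2 ⟨t, ht⟩)⟩
      left_inv := fun x ↦ rfl
      right_inv := fun j ↦ rfl }
  haveI : Finite (Submodule.torsionBySet (HeckeRing0 L 2) (J0 L) 𝔪) := J0.finite_torsionBySet L two_ne_zero (by rw [← h22] at h2; exact h2)
  letI : Field (HeckeRing0 L 2 ⧸ 𝔪) := Ideal.Quotient.field 𝔪
  haveI : Module.Finite (HeckeRing0 L 2 ⧸ 𝔪) (Submodule.torsionBySet (HeckeRing0 L 2) (J0 L) 𝔪) := Module.Finite.of_finite
  have hcard4 : Nat.card {x : (Submodule.torsionBy (HeckeRing0 L 2) (J0 L) ((2 : ℕ) : HeckeRing0 L 2)) // ∀ t ∈ 𝔪, t • x = 0} = 4 := by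
    rw [Nat.card_congr e, Module.natCard_eq_pow_finrank (K := HeckeRing0 L 2 ⧸ 𝔪), hq, hsub]
    norm_num
  -- (4) the `𝕋`-linear map `Λ → (Submodule.torsionBy (HeckeRing0 L 2) (J0 L) ((2 : ℕ) : HeckeRing0 L 2))`, `x ↦ [x/2]`
  let D : (periodHomologyHecke L) →ₗ[HeckeRing0 L 2] (Submodule.torsionBy (HeckeRing0 L 2) (J0 L) ((2 : ℕ) : HeckeRing0 L 2)) :=
    { toFun := fun x ↦ ⟨J0.divMap L 2 ⟨x, (mem_periodHomologyHecke L).mp x.2⟩, by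
        rw [Submodule.mem_torsionBy_iff, Nat.cast_smul_eq_nsmul]
        exact J0.nsmul_divMap L 2 _⟩
      map_add' := fun x y ↦ by
        apply Subtype.ext
        change J0.divMap L 2 ⟨(x : Module.Dual ℂ (CuspForm (Gamma0 L) 2)) + (y : Module.Dual ℂ (CuspForm (Gamma0 L) 2)), _⟩ =
          J0.divMap L 2 _ + J0.divMap L 2 _
        rw [← map_add]
        rfl
      map_smul' := fun t x ↦ by
        apply Subtype.ext
        change Submodule.Quotient.mk ((2 : ℂ)⁻¹ • (t • (x : Module.Dual ℂ (CuspForm (Gamma0 L) 2)))) =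
          t • Submodule.Quotient.mk ((2 : ℂ)⁻¹ • (x : Module.Dual ℂ (CuspForm (Gamma0 L) 2)))
        rw [← Submodule.Quotient.mk_smul, heckeRing0_smul_complex_smul] }
  have hDval : ∀ x : (periodHomologyHecke L), ((D x : (Submodule.torsionBy (HeckeRing0 L 2) (J0 L) ((2 : ℕ) : HeckeRing0 L 2))) : J0 L) = Submodule.Quotient.mk ((2 : ℂ)⁻¹ • (x : Module.Dual ℂ _)) := fun x ↦ rfl
  -- `D` is onto `(Submodule.torsionBy (HeckeRing0 L 2) (J0 L) ((2 : ℕ) : HeckeRing0 L 2))`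
  have hDsurj : Function.Surjective D := by
    intro m
    have hm : (m : J0 L) ∈ Submodule.torsionBy (HeckeRing0 L 2) (J0 L) (2 : ℕ) := m.2
    obtain ⟨y, hy⟩ := J0.mem_range_divMap L two_ne_zero hm
    refine ⟨⟨y, (mem_periodHomologyHecke L).mpr y.2⟩, Subtype.ext ?_⟩
    rw [← hy]
    rfl
  -- kernel of `D` lies in `𝔪 • ⊤` (it is `2Λ`)
  have hDker : ∀ z : (periodHomologyHecke L), D z = 0 → z ∈ (𝔪 • ⊤ : Submodule (HeckeRing0 L 2) (periodHomologyHecke L)) := by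
    intro z hz
    have hz' : Submodule.Quotient.mk (p := periodHomologyHecke L) ((2 : ℂ)⁻¹ • (z : Module.Dual ℂ _)) = 0 := by
      rw [← hDval, hz]; rfl
    rw [Submodule.Quotient.mk_eq_zero] at hz'
    -- `z = 2 • w` with `w = z/2 ∈ Λ`
    have hzw : z = (2 : HeckeRing0 L 2) • (⟨(2 : ℂ)⁻¹ • (z : Module.Dual ℂ _), hz'⟩ : (periodHomologyHecke L)) := by
      apply Subtype.ext
      rw [Submodule.coe_smul, show (2 : HeckeRing0 L 2) = ((2 : ℕ) : HeckeRing0 L 2) from h22.symm, Nat.cast_smul_eq_nsmul,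
        ← Nat.cast_smul_eq_nsmul ℂ, smul_smul]
      norm_num
    rw [hzw]
    exact Submodule.smul_mem_smul h2 Submodule.mem_top
  -- (5) the induced map on quotients is injective, so `|Λ/𝔪Λ| ≤ |(Submodule.torsionBy (HeckeRing0 L 2) (J0 L) ((2 : ℕ) : HeckeRing0 L 2))/𝔪(Submodule.torsionBy (HeckeRing0 L 2) (J0 L) ((2 : ℕ) : HeckeRing0 L 2))| ≤ 4`
  have hmaple : Submodule.map D (𝔪 • ⊤ : Submodule (HeckeRing0 L 2) (periodHomologyHecke L)) = (𝔪 • ⊤ : Submodule (HeckeRing0 L 2) (Submodule.torsionBy (HeckeRing0 L 2) (J0 L) ((2 : ℕ) : HeckeRing0 L 2))) := by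
    rw [Submodule.map_smul'', Submodule.map_top, LinearMap.range_eq_top.mpr hDsurj]
  have hinj : ∀ x : (periodHomologyHecke L), D x ∈ (𝔪 • ⊤ : Submodule (HeckeRing0 L 2) (Submodule.torsionBy (HeckeRing0 L 2) (J0 L) ((2 : ℕ) : HeckeRing0 L 2))) → x ∈ (𝔪 • ⊤ : Submodule (HeckeRing0 L 2) (periodHomologyHecke L)) := by
    intro x hx
    rw [← hmaple] at hx
    obtain ⟨y, hy, hyx⟩ := hx
    have hker : D (x - y) = 0 := by rw [map_sub, hyx, sub_self]
    have := hDker _ hker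
    have e : x = y + (x - y) := by abel
    rw [e]
    exact add_mem hy this
  let Dq : ((periodHomologyHecke L) ⧸ (𝔪 • ⊤ : Submodule (HeckeRing0 L 2) (periodHomologyHecke L))) →ₗ[HeckeRing0 L 2] ((Submodule.torsionBy (HeckeRing0 L 2) (J0 L) ((2 : ℕ) : HeckeRing0 L 2)) ⧸ (𝔪 • ⊤ : Submodule (HeckeRing0 L 2) (Submodule.torsionBy (HeckeRing0 L 2) (J0 L) ((2 : ℕ) : HeckeRing0 L 2)))) :=
    Submodule.mapQ _ _ D (fun y hy ↦ by rw [Submodule.mem_comap, ← hmaple]; exact Submodule.mem_map_of_mem hy)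
  have hDq : Function.Injective Dq := by
    rw [← LinearMap.ker_eq_bot, Submodule.eq_bot_iff]
    intro q hq
    obtain ⟨x, rfl⟩ := Submodule.Quotient.mk_surjective _ q
    rw [LinearMap.mem_ker, Submodule.mapQ_apply, Submodule.Quotient.mk_eq_zero] at hq
    exact (Submodule.Quotient.mk_eq_zero _).mpr (hinj x hq)
  haveI : Finite ((Submodule.torsionBy (HeckeRing0 L 2) (J0 L) ((2 : ℕ) : HeckeRing0 L 2)) ⧸ (𝔪 • ⊤ : Submodule (HeckeRing0 L 2) (Submodule.torsionBy (HeckeRing0 L 2) (J0 L) ((2 : ℕ) : HeckeRing0 L 2)))) := Finite.of_surjective _ (Submodule.Quotient.mk_surjective _)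
  haveI hPfin : Finite ((periodHomologyHecke L) ⧸ (𝔪 • ⊤ : Submodule (HeckeRing0 L 2) (periodHomologyHecke L))) := Finite.of_injective Dq hDq
  have hcardP : Nat.card ((periodHomologyHecke L) ⧸ (𝔪 • ⊤ : Submodule (HeckeRing0 L 2) (periodHomologyHecke L))) ≤ 4 :=
    (Nat.card_le_card_of_injective Dq hDq).trans (hle.trans hcard4.le)
  -- (6) the induced map on quotients is also ONTO, so `|Λ/𝔪Λ| = |M/𝔪M|` (`M = J₀(L)[2]`)
  have hDqsurj : Function.Surjective Dq := by
    intro q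
    obtain ⟨m, rfl⟩ := Submodule.Quotient.mk_surjective _ q
    obtain ⟨x, rfl⟩ := hDsurj m
    exact ⟨Submodule.Quotient.mk x, rfl⟩
  have hcardEq : Nat.card ((periodHomologyHecke L) ⧸ (𝔪 • ⊤ : Submodule (HeckeRing0 L 2) (periodHomologyHecke L))) =
      Nat.card ((Submodule.torsionBy (HeckeRing0 L 2) (J0 L) ((2 : ℕ) : HeckeRing0 L 2)) ⧸ (𝔪 • ⊤ : Submodule (HeckeRing0 L 2) (Submodule.torsionBy (HeckeRing0 L 2) (J0 L) ((2 : ℕ) : HeckeRing0 L 2)))) :=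
    Nat.card_congr (Equiv.ofBijective Dq ⟨hDq, hDqsurj⟩)
  -- (7) `|M[𝔪]| ≤ |M/𝔪M|` from the RIGHT kernel, hence `|Λ/𝔪Λ| = 4`
  have hright' : ∀ y : (Submodule.torsionBy (HeckeRing0 L 2) (J0 L) ((2 : ℕ) : HeckeRing0 L 2)), (∀ x, B x y = 0) → y = 0 := hright
  have hge := natCard_torsion_le_natCard_quotient_of_pairing h2M B hbal hright' 𝔪
  have hcard : Nat.card ((periodHomologyHecke L) ⧸ (𝔪 • ⊤ : Submodule (HeckeRing0 L 2) (periodHomologyHecke L))) = 4 := by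
    rw [hcardEq]; omega
  -- (8) `4 = 2 ^ dim`
  haveI : Module.Finite (HeckeRing0 L 2 ⧸ 𝔪) ((periodHomologyHecke L) ⧸ (𝔪 • ⊤ : Submodule (HeckeRing0 L 2) (periodHomologyHecke L))) :=
    Module.Finite.of_finite
  have hpow := Module.natCard_eq_pow_finrank (K := HeckeRing0 L 2 ⧸ 𝔪)
    (V := (periodHomologyHecke L) ⧸ (𝔪 • ⊤ : Submodule (HeckeRing0 L 2) (periodHomologyHecke L)))
  rw [hcard, hq] at hpow
  have h4 : (2 : ℕ) ^ 2 = 2 ^ Module.finrank (HeckeRing0 L 2 ⧸ 𝔪)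
      ((periodHomologyHecke L) ⧸ (𝔪 • ⊤ : Submodule (HeckeRing0 L 2) (periodHomologyHecke L))) := by
    rw [← hpow]; norm_num
  exact (Nat.pow_right_injective (le_refl 2) h4).symm

end PeriodHomology

/-! ## §3 The curve-level cosocle statement from PUB² {SD, Bz} — the two roads meet at `hcosW` -/

section Supply

set_option linter.unusedTactic false in
set_option linter.unreachableTactic false in
/-- **Cosocle multiplicity one at the mod-`2` eigen-ideals of good-supersingular-at-`2` curves from PUB² {SD, Bz}**: the hypothesis `hcosW` of
`thetaLayerLambdaCongruenceAtTwo_of_cosocleW` (and of the K1 twins) follows from `heckeSelfDual_torsionBy_J0` and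
`buzzard2000_multiplicityOne_gamma0` — Buzzard at the eigen-ideal by `finrank_torsionBySet_eq_two_of_buzzard`, then §2 with the self-duality
pairing. So the curve-level statement `hcosW` is the MEET of the two floors: PUB² {SD, Bz} ⟹ `hcosW` ⟸ {Bz read on the Picard carrier}
(`cosocleAtEigenIdeal_of_cosocleFact`), and Kan⁺ / K1 depend on print ONLY through `hcosW`. [cite: Buzzard2000LevelLoweringModTwo, Prop. 2.4]
[cite: DarmonDiamondTaylor1995, §1.6 Lemma 1.38 and §4.5 (p. 134)] -/
theorem cosocleW_of_sdBz (hSD : heckeSelfDual_torsionBy_J0) (hBz : buzzard2000_multiplicityOne_gamma0) :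
    ∀ (W : WeierstrassCurve ℚ) [W.IsElliptic] [W.IsGloballyMinimal], GoodSS W 2 →
      ∀ (L : ℕ) [NeZero L], Odd L →
      (∀ v : HeightOneSpectrum (𝓞 ℚ), ¬ ((primesEquiv v : ℕ) ∣ 2 * L) → W.HasGoodReductionAt v) →
      ∀ (𝔪 : Ideal (HeckeRing0 L 2)), 𝔪.IsMaximal → (2 : HeckeRing0 L 2) ∈ 𝔪 → Nat.card (HeckeRing0 L 2 ⧸ 𝔪) = 2 →
      (∀ (q : ℕ) (hq : q.Prime), ¬ q ∣ L → HeckeRing0.T L 2 q hq - (W.LFunction q : HeckeRing0 L 2) ∈ 𝔪) →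
      Module.finrank (HeckeRing0 L 2 ⧸ 𝔪)
        (periodHomologyHecke L ⧸ (𝔪 • ⊤ : Submodule (HeckeRing0 L 2) (periodHomologyHecke L))) = 2 := by
  intro W _ _ hss L _ hL hgood 𝔪 h𝔪 h2 hq hT
  haveI := h𝔪
  haveI : Fact (Nat.Prime 2) := ⟨Nat.prime_two⟩
  obtain ⟨B, hbal, hleft, hright⟩ := hSD L 2
  -- ROBUST under both typings of `buzzard2000_multiplicityOne_gamma0` (Galois hypotheses discharged by `of_buzzardHypotheses` either way):
  first
    -- Picard typing (conclusion `dim Λ/𝔪Λ = 2`): the fact's conclusion IS the goal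
    | exact of_buzzardHypotheses W hss L hgood 𝔪 hq hT (hBz L hL 𝔪 h𝔪 h2)
    -- Albanese typing (today; conclusion `dim J₀(L)[𝔪] = 2`): convert with the two-sided self-duality pairing (§2)
    | exact finrank_periodHomology_quotient_eq_two_of_selfDual_sub 𝔪 h2 hq
        (of_buzzardHypotheses W hss L hgood 𝔪 hq hT (hBz L hL 𝔪 h𝔪 h2)) B hbal hleft hright

/-- The same from the route's alias items 27800 `HeckeSelfDualTorsionJ0Input` and 27798 `BuzzardMultiplicityOneGammaZeroInput` (route decls BY NAME),
so a skeleton stub carrying the curve-level statement closes as `cosocleW_of_aliasInputs h27800 h27798` under the CURRENT typing, and as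
`cosocleAtEigenIdeal_of_cosocleFact h` under the Picard typing. [cite: Buzzard2000LevelLoweringModTwo, Prop. 2.4] -/
theorem cosocleW_of_aliasInputs (h27800 : HeckeSelfDualTorsionJ0Input) (h27798 : BuzzardMultiplicityOneGammaZeroInput) :
    ∀ (W : WeierstrassCurve ℚ) [W.IsElliptic] [W.IsGloballyMinimal], GoodSS W 2 →
      ∀ (L : ℕ) [NeZero L], Odd L →
      (∀ v : HeightOneSpectrum (𝓞 ℚ), ¬ ((primesEquiv v : ℕ) ∣ 2 * L) → W.HasGoodReductionAt v) →
      ∀ (𝔪 : Ideal (HeckeRing0 L 2)), 𝔪.IsMaximal → (2 : HeckeRing0 L 2) ∈ 𝔪 → Nat.card (HeckeRing0 L 2 ⧸ 𝔪) = 2 →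
      (∀ (q : ℕ) (hq : q.Prime), ¬ q ∣ L → HeckeRing0.T L 2 q hq - (W.LFunction q : HeckeRing0 L 2) ∈ 𝔪) →
      Module.finrank (HeckeRing0 L 2 ⧸ 𝔪)
        (periodHomologyHecke L ⧸ (𝔪 • ⊤ : Submodule (HeckeRing0 L 2) (periodHomologyHecke L))) = 2 :=
  cosocleW_of_sdBz h27800 h27798

/-- The same from the PUB⁵ bundle item 27435 `PublishedInputsHeckeAtTwo` (conjuncts `.2.1`, `.2.2.1` only). [cite: Buzzard2000LevelLoweringModTwo, Prop. 2.4] -/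
theorem cosocleW_of_pub (hPUB : PublishedInputsHeckeAtTwo) :
    ∀ (W : WeierstrassCurve ℚ) [W.IsElliptic] [W.IsGloballyMinimal], GoodSS W 2 →
      ∀ (L : ℕ) [NeZero L], Odd L →
      (∀ v : HeightOneSpectrum (𝓞 ℚ), ¬ ((primesEquiv v : ℕ) ∣ 2 * L) → W.HasGoodReductionAt v) →
      ∀ (𝔪 : Ideal (HeckeRing0 L 2)), 𝔪.IsMaximal → (2 : HeckeRing0 L 2) ∈ 𝔪 → Nat.card (HeckeRing0 L 2 ⧸ 𝔪) = 2 →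
      (∀ (q : ℕ) (hq : q.Prime), ¬ q ∣ L → HeckeRing0.T L 2 q hq - (W.LFunction q : HeckeRing0 L 2) ∈ 𝔪) →
      Module.finrank (HeckeRing0 L 2 ⧸ 𝔪)
        (periodHomologyHecke L ⧸ (𝔪 • ⊤ : Submodule (HeckeRing0 L 2) (periodHomologyHecke L))) = 2 :=
  cosocleW_of_sdBz hPUB.2.1 hPUB.2.2.1

end Supply

end Summit.BirchSwinnertonDyer.BirchSwinnertonDyer.Theorems.ThetaLayerLambdaCongruenceAtTwo

end
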